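import Summits.Ventures.PercRepro.ProfileGapMonoGenericA

/-!
# PercRepro — THE LOCAL FORM OF `(GM)_q` AT AN ARBITRARY NON-LOOP POINT (p5, gen 21; `proofs/P5-GM1.md` §14;
announced INBOX 10073)

For a non-loop `z`, `GapMonoQ M z q u` is equivalent to the local inequality
`Σ_{B ∈ R_q(M∖z)} (demand_M(B) − demand_{M∖z}(B)) + Σ_{B' ∈ R_{q−1}(M／z)} demand_M(insert z B')
  ≤ C(u,q) · #(levelSetCoQ M q u \ levelSetCoQ (M∖z) q u)`
— the δ-sum of the rank-`q` sets avoiding `z` whose complement loses rank when `z` is erased, plus the demand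
of the rank-`q` sets through `z`, against the NEW co-rank-`q` rank-`u` sets of `M` (through `z`, or LOST).
At a `q`-generic point the δ-sum vanishes (ProfileGapMonoGenericA), at a coloop the right side is the coloop
identity (ProfileGapMonoColoopQ); this lemma states the general local inequality in the kernel for every point.

* `sum_demand_split_nonloop` — the demand sum of `M` through the two families;
* **`gapMonoQ_iff_local`**.
-/

open scoped Matroid

namespace PercRepro.Cogirth

open Finset ThmH Skew Shadow Profile

variable {α : Type} [DecidableEq α] {M : Matroid α} [M.Finite]

section Local

variable {z : α} {q u : ℕ} (hz : z ∈ gr M) (hz1 : rk M {z} = 1)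

include hz hz1 in
/-- The demand sum of `M` at a non-loop `z`: the sets avoiding `z` (`= R_q(M∖z)`, with their `M`-demands) and the
sets through `z` (`insert z` of `R_{q−1}(M／z)`), `1 ≤ q`. -/
theorem sum_demand_split_nonloop (hq : 1 ≤ q) :
    ∑ B ∈ Rq M q, demand M q u B =
      ∑ B ∈ Rq (M ＼ ({z} : Set α)) q, demand M q u B +
        ∑ B' ∈ Rq (M ／ ({z} : Set α)) (q - 1), demand M q u (insert z B') := by
  rw [← sum_filter_add_sum_filter_not (Rq M q) (fun B => z ∈ B) (demand M q u), add_comm,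
    Rq_delete_eq_filter, Rq_filter_mem_eq_image_contract hz hz1 hq]
  have hinj : Set.InjOn (insert z) ((Rq (M ／ ({z} : Set α)) (q - 1) : Finset (Finset α)) : Set (Finset α)) := by
    intro B hB B' hB' h
    rw [mem_coe, mem_Rq, gr_contract'] at hB hB'
    have h1 : z ∉ B := fun hzB => (mem_erase.1 (hB.1 hzB)).1 rfl
    have h2 : z ∉ B' := fun hzB => (mem_erase.1 (hB'.1 hzB)).1 rfl
    rw [← erase_insert h1, ← erase_insert h2, h]
  rw [sum_image hinj]

/-- The co-rank-`q` rank-`u` sets of `M ∖ z` are co-rank-`q` rank-`u` sets of `M`. -/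
theorem levelSetCoQ_delete_subset' (z : α) (q u : ℕ) :
    levelSetCoQ (M ＼ ({z} : Set α)) q u ⊆ levelSetCoQ M q u := by
  rw [levelSetCoQ_delete_eq_filter]; exact filter_subset _ _

include hz hz1 in
/-- **The local form of `(GM)_q` at a non-loop point** (`1 ≤ q`). -/
theorem gapMonoQ_iff_local (hq : 1 ≤ q) :
    GapMonoQ M z q u ↔
      ∑ B ∈ Rq (M ＼ ({z} : Set α)) q, (demand M q u B - demand (M ＼ ({z} : Set α)) q u B) +
          ∑ B' ∈ Rq (M ／ ({z} : Set α)) (q - 1), demand M q u (insert z B') ≤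
        u.choose q * (levelSetCoQ M q u \ levelSetCoQ (M ＼ ({z} : Set α)) q u).card := by
  unfold GapMonoQ
  rw [sum_demand_split_nonloop hz hz1 hq, card_sdiff_of_subset (levelSetCoQ_delete_subset' z q u)]
  have hle : ∀ B ∈ Rq (M ＼ ({z} : Set α)) q, demand (M ＼ ({z} : Set α)) q u B ≤ demand M q u B :=
    fun B _ => demand_delete_le q u B z
  have hsplit : ∑ B ∈ Rq (M ＼ ({z} : Set α)) q, demand M q u B =
      ∑ B ∈ Rq (M ＼ ({z} : Set α)) q, (demand M q u B - demand (M ＼ ({z} : Set α)) q u B) +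
        ∑ B ∈ Rq (M ＼ ({z} : Set α)) q, demand (M ＼ ({z} : Set α)) q u B := by
    rw [← sum_add_distrib]
    exact sum_congr rfl (fun B hB => by have := hle B hB; omega)
  have hW := card_le_card (levelSetCoQ_delete_subset' (M := M) z q u)
  rw [hsplit, Nat.mul_sub]
  have hWW : u.choose q * (levelSetCoQ (M ＼ ({z} : Set α)) q u).card ≤ u.choose q * (levelSetCoQ M q u).card :=
    Nat.mul_le_mul_left _ hW
  omega

end Local

end PercRepro.Cogirth
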